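import Summits.BirchSwinnertonDyer.BirchSwinnertonDyer.Theorems.AdditiveKolyvaginRoadLevelKolyvaginSystemsAdditiveIffKolyvaginPrimitive
import Summits.BirchSwinnertonDyer.BirchSwinnertonDyer.Theorems.AdditiveKolyvaginRoadLevelKolyvaginSystemsAdditiveOfKolyvaginPrimitiveOfPoitouTate
import Summits.BirchSwinnertonDyer.BirchSwinnertonDyer.Theorems.SchneiderFreeAdditiveX3PoitouTateSelmerDualityHolds
import HarnessLib

/-!
# Route `AdditiveKolyvaginRoad`, crux `LevelKolyvaginSystemsAdditive` (item stmt-BirchSwinnertonDyer-21396, KS′):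
# the Poitou–Tate conjunct of the DUAL bundle DISCHARGED — `KolyvaginPrimitiveAdditive → LevelKolyvaginSystemsAdditive`
# with NO displayed input, DUAL ≡ its Cassels–Tate conjunct, and the line's E-side binders as hypothesis-free theorems
# (cell `pub/bsd-wall`, extra width seat `bsd-wall-akr-p2x-w4` g2; `--supports stmt-BirchSwinnertonDyer-21396`, helper)

WHY. The route's second published bundle `PublishedDualityInputsAdditiveKoly` (item stmt-BirchSwinnertonDyer-21333, DUAL) is the
conjunction (CT) `∀ K, casselsTate_levelInputs K` ∧ (PT) `∀ K, poitouTate_selmerStructure_duality K`. Since 2026-08-28 (cell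
`bsd-schneider`, door-c4 g18, p624636) the second conjunct is a THEOREM of the tree for every number field:
`SchneiderFreeAdditiveX3.PoitouTateReduction.poitouTate_selmerStructure_duality_holds` (Milne *ADT* I Cor. 2.3, Thm. 2.6,
Thm. 4.10 (b); Howard 2004 Thm. 2.1.11 — kernel-checked on that cell's presentation road). No file of this route consumed it yet;
every E-side theorem of the KS′ line (LOC, J2, (R′), DICH, (Twin), the DICH door KPA′ ⟹ KS′) displayed it as `hPT` ∕ `hDual.2`.

WHAT (pure by-name composition; nothing is re-derived, no landed declaration is restated with a changed meaning).
* (§1 — no declaration) the PT conjunct of DUAL in its `∀ K` binder shape is the term `fun K _ _ ↦ poitouTate_selmerStructure_duality_holds K`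
  (by name; the tree also has it as `SchneiderFreeAdditiveX3.ControlDischarged.pt_selmer_forall`, not imported here to keep this file
  out of route `SchneiderFreeAdditiveX3Upper`'s theses cone).
* §2 `publishedDualityInputsAdditiveKoly_of_casselsTate`, `publishedDualityInputsAdditiveKoly_iff_casselsTate` — **DUAL ≡ CT**: item 21333
  is now exactly the levelwise Cassels–Tate fact `∀ K, casselsTate_levelInputs K` (whose last open input, Milne I 4.10 (a) for `Ш²` in
  cochain form, is held by cell SOED, `casselsTate_levelInputs_of_shaTwoCochain`).
* §3 **`levelKolyvaginSystemsAdditive_of_kolyvaginPrimitiveAdditive_free : KolyvaginPrimitiveAdditive → LevelKolyvaginSystemsAdditive`** —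
  the crux KS′ (r8, 21396) follows from the route's target crux KPA′ (r2, 21400) with ZERO displayed inputs (width seat w5's DICH door
  `…_of_poitouTate`, p630671, at the PT theorem). Director ruling W-84 (α) («KS′ is a corollary of KPA′»), this direction, is now
  unconditional in the kernel.
* §4 the capstones with CT in place of DUAL: `kolyvaginPrimitiveAdditive_of_casselsTate_of_levelSystems : PUB → CT → KS′ → KPA′` and
  `levelKolyvaginSystemsAdditive_iff_kolyvaginPrimitiveAdditive_of_casselsTate : PUB → CT → (KS′ ↔ KPA′)` (lead g3's p629856 at §2).
* §5 the line's E-side binders as HYPOTHESIS-FREE theorems at every ♯-type frame (`K` imaginary quadratic, `d_K < −4`, `p` odd resp.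
  `≥ 5`, `ρ̄_{E,p}` onto, complex conjugation `c ≠ 1`): LOC `nonempty_kolyvaginLocalPackageP` (W. Zhang's local package, the stub LOC of
  crux r2's line), J2 `twoPrimeJump` (the two-prime jump), (R′) `selQP_raise` (admissible raise), DICH `selmerDichotomy` (Lower ∧ Raise ∧
  TwoStep for every family with the level dictionary) and (Twin) `twin` (Drop ∧ Rise ∧ Jump for every family with the mixed dictionary)
  — each the tree's `…_of_poitouTate` ∕ `…_free` theorem at the PT theorem, signatures otherwise VERBATIM.

CONSEQUENCE FOR THE REGISTERED LINE `epsilon_matched_retyping` (skeleton v12, stubs S1″ research ∕ S0′ = KL ∧ PUB ∧ DUAL): S0′ may be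
read KL ∧ PUB ∧ CT (feed `publishedDualityInputsAdditiveKoly_of_casselsTate hCT` where `hDual` is consumed); the displayed refereed
inputs of the line are Kriz–Li 1.16, the PUB bundle 20137 and the levelwise Cassels–Tate fact — Poitou–Tate is no longer among them.

HONEST FRAMING: theorems only; 0 definitions, 0 named facts, 0 `sorry`, standard axioms. §3 and §5 are UNCONDITIONAL; §2/§4 are
by-name equivalences ∕ implications between the route's items. Nothing here proves KS′ or KPA′ (Kolyvagin's conjecture mod `p` at an
additive prime `p ≥ 5`, OPEN at `p² ∣ N`); no summit statement is proved; the Birch–Swinnerton-Dyer conjecture is NOT proved by any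
of this.

References: [cite: MilneADT2006, Ch. I, Cor. 2.3, Thm. 2.6, Thm. 4.10 (b)] [cite: Howard2004HeegnerKolyvagin, Thm. 2.1.11, Lemma 2.5.3]
[cite: WZhang2014, Thm. 4.3, Lemma 5.3, Prop. 5.4, Thm. 7.2, §8.1, Lemma 8.2, Lemma 8.4, Thm. 9.1, §9] [cite: MazurRubin2004, Lemma 4.1.7]
[cite: McCallumLMS1991, §5, Thm. 5.4, Thm. 5.8] [cite: GrossLMS1991, §5 (5.1), Prop. 8.1–8.2].
-/

-- single-conjunct summit: `Summit.BirchSwinnertonDyer.BirchSwinnertonDyer.…` repeats the name by design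
set_option linter.dupNamespace false
set_option autoImplicit false

noncomputable section

open scoped Classical

namespace Summit.BirchSwinnertonDyer.BirchSwinnertonDyer.Theorems.AdditiveKoly

open WeierstrassCurve NumberField IsDedekindDomain Field
  Literature.NumberTheory.EllipticCurves Literature.NumberTheory.EllipticCurves.ModularForms
  Literature.NumberTheory.EllipticCurves.Rank1Residual Literature.NumberTheory.GaloisRepresentations Module
  Literature.NumberTheory.GaloisCohomology
  Summit.BirchSwinnertonDyer.Rank1Residual.X11b.Three.Koly
  Summit.BirchSwinnertonDyer.BirchSwinnertonDyer.Theses.AdditiveKolyvaginRoad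
open Summit.BirchSwinnertonDyer.BirchSwinnertonDyer.Theorems.SchneiderFreeAdditiveX3.PoitouTateReduction
  (poitouTate_selmerStructure_duality_holds)

/-! ## §2 DUAL ≡ its Cassels–Tate conjunct -/

/-- **DUAL from the levelwise Cassels–Tate fact alone**: `(∀ K, casselsTate_levelInputs K) → PublishedDualityInputsAdditiveKoly`
(item stmt-BirchSwinnertonDyer-21333), the Poitou–Tate conjunct being the tree theorem `poitouTate_selmerStructure_duality_holds` (cell `bsd-schneider`, p624636).
[cite: MilneADT2006, Ch. I, Thm. 4.10 (b), §6 Prop. 6.9, Thm. 6.13] [cite: Howard2004HeegnerKolyvagin, Thm. 2.1.11] -/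
theorem publishedDualityInputsAdditiveKoly_of_casselsTate
    (hCT : ∀ (K : Type) [Field K] [NumberField K], casselsTate_levelInputs K) :
    PublishedDualityInputsAdditiveKoly :=
  ⟨hCT, fun K _ _ ↦ poitouTate_selmerStructure_duality_holds K⟩

/-- **DUAL ≡ CT**: the route's duality bundle `PublishedDualityInputsAdditiveKoly` (item 21333) is EQUIVALENT to its first conjunct, the
levelwise Cassels–Tate fact `∀ K, casselsTate_levelInputs K` — so item 21333 closes the moment that Literature fact is a theorem
(its one remaining input, Milne I 4.10 (a) for `Ш²(K, E[q])` in cochain form, is what `casselsTate_levelInputs_of_shaTwoCochain` displays).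
[cite: MilneADT2006, Ch. I, Thm. 4.10 (a)(b), §6 Prop. 6.9, Thm. 6.13] [cite: Howard2004HeegnerKolyvagin, Thm. 2.1.11] -/
theorem publishedDualityInputsAdditiveKoly_iff_casselsTate :
    PublishedDualityInputsAdditiveKoly ↔ ∀ (K : Type) [Field K] [NumberField K], casselsTate_levelInputs K :=
  ⟨fun h ↦ h.1, publishedDualityInputsAdditiveKoly_of_casselsTate⟩

/-! ## §3 KS′ from KPA′ — no displayed input -/

/-- **`KolyvaginPrimitiveAdditive → LevelKolyvaginSystemsAdditive`, UNCONDITIONALLY.** The crux KS′ (item stmt-BirchSwinnertonDyer-21396,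
r8 of route `AdditiveKolyvaginRoad`) follows from the route's target crux KPA′ (item stmt-BirchSwinnertonDyer-21400, r2) with NO published
bundle and NO displayed E-side binder: width seat akr-p2x-w5's DICH door `levelKolyvaginSystemsAdditive_of_kolyvaginPrimitiveAdditive_of_poitouTate`
(the intended family `exists_transverseLevelSpaces`, the dichotomies (Lower) ∕ (Raise) ∕ (TwoStep) `dich_of_poitouTate`, the synthetic system
`nonempty_levelKolyvaginSystemP_of_selmerDichotomy` run on the KPA′ witness of the frame) at the Poitou–Tate THEOREM
`SchneiderFreeAdditiveX3.PoitouTateReduction.poitouTate_selmerStructure_duality_holds` (p624636). Director ruling W-84 (α), this direction, unconditional in the kernel. KPA′ is OPEN at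
`p² ∣ N`; this closes nothing. [cite: WZhang2014, Thm. 4.3, Lemma 5.3, Prop. 5.4, Thm. 7.2, §8.1, Lemma 8.2, Lemma 8.4]
[cite: MazurRubin2004, Lemma 4.1.7] [cite: MilneADT2006, Ch. I, Thm. 4.10 (b)] -/
theorem levelKolyvaginSystemsAdditive_of_kolyvaginPrimitiveAdditive_free (hKPA : KolyvaginPrimitiveAdditive) :
    LevelKolyvaginSystemsAdditive :=
  levelKolyvaginSystemsAdditive_of_kolyvaginPrimitiveAdditive_of_poitouTate
    (fun K _ _ ↦ poitouTate_selmerStructure_duality_holds K) hKPA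

/-! ## §4 The capstones with the Cassels–Tate fact in place of DUAL -/

/-- **KPA′ from KS′ modulo PUB and the levelwise Cassels–Tate fact** (BOT′-free converse): `PublishedInputsAdditiveKoly →
(∀ K, casselsTate_levelInputs K) → LevelKolyvaginSystemsAdditive → KolyvaginPrimitiveAdditive` — the tree's kernel
`kolyvaginPrimitiveAdditive_of_published_of_levelSystems` (parity P from PUB + Cassels–Tate; rank lowering A1; LOC and J2 from Poitou–Tate, now
a theorem; the induction engine) with DUAL assembled by `publishedDualityInputsAdditiveKoly_of_casselsTate`.
[cite: WZhang2014, §9 proof of Thm. 9.1, Lemma 5.3, Thm. 7.2, Lemma 8.2] [cite: GrossLMS1991, §4] [cite: McCallumLMS1991, §5, Thm. 5.4] -/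
theorem kolyvaginPrimitiveAdditive_of_casselsTate_of_levelSystems (hPUB : PublishedInputsAdditiveKoly)
    (hCT : ∀ (K : Type) [Field K] [NumberField K], casselsTate_levelInputs K) (hKS : LevelKolyvaginSystemsAdditive) :
    KolyvaginPrimitiveAdditive :=
  kolyvaginPrimitiveAdditive_of_published_of_levelSystems hPUB (publishedDualityInputsAdditiveKoly_of_casselsTate hCT) hKS

/-- **KS′ ⟺ KPA′ modulo PUB and the levelwise Cassels–Tate fact, BY NAME**: `PublishedInputsAdditiveKoly → (∀ K, casselsTate_levelInputs K) →
(LevelKolyvaginSystemsAdditive ↔ KolyvaginPrimitiveAdditive)` — lead g3's `levelKolyvaginSystemsAdditive_iff_kolyvaginPrimitiveAdditive_of_published`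
(p629856) with the Poitou–Tate conjunct of DUAL discharged; (←) is even input-free (`levelKolyvaginSystemsAdditive_of_kolyvaginPrimitiveAdditive_free`).
The two Kolyvagin cruxes r8 (21396) and r2 (21400) of route `AdditiveKolyvaginRoad` are ONE statement modulo PUB (20137) and CT alone.
[cite: WZhang2014, Thm. 1.1, Thm. 9.1, §9] [cite: MilneADT2006, Ch. I, Thm. 4.10 (b), Thm. 6.13] -/
theorem levelKolyvaginSystemsAdditive_iff_kolyvaginPrimitiveAdditive_of_casselsTate (hPUB : PublishedInputsAdditiveKoly)
    (hCT : ∀ (K : Type) [Field K] [NumberField K], casselsTate_levelInputs K) :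
    LevelKolyvaginSystemsAdditive ↔ KolyvaginPrimitiveAdditive :=
  ⟨kolyvaginPrimitiveAdditive_of_casselsTate_of_levelSystems hPUB hCT, levelKolyvaginSystemsAdditive_of_kolyvaginPrimitiveAdditive_free⟩

/-! ## §5 The line's E-side binders, hypothesis-free -/

section Frame

variable (W : WeierstrassCurve ℚ) (K : Type) [Field K] [NumberField K] (p : ℕ) [W.IsElliptic] [W.IsGloballyMinimal]
  [Fact p.Prime] (ι : K →+* ℂ) (c : K ≃ₐ[ℚ] K) [Module (ZMod p) (Vp W K p)]

/-- **LOC, unconditionally**: W. Zhang's local–global package `KolyvaginLocalPackageP W K p ι c` (the registered stub LOC of crux r2's line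
`birth`, p562934 modulo Poitou–Tate) EXISTS at every ♯-type frame — `K` imaginary quadratic with `d_K < −4`, `p` odd, `ρ̄_{E,p}` onto, `c ≠ 1`:
akr-p1's `kolyvaginLocalPackageP_of_poitouTate` at the Poitou–Tate theorem. (Instance binders as there: the `ZMod p`-structures on the local
`H¹(K_v, E[p])`, compact local Galois groups, `E[p](K̄)` finite — all supplied by the tree's standard recipe at any call site.)
[cite: WZhang2014, §8.1, Lemma 8.1, Lemma 8.2, Lemma 8.4] [cite: MilneADT2006, Ch. I, Cor. 2.3, Thm. 4.10 (b)] [cite: GrossLMS1991, Prop. 8.1, Prop. 9.6] -/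
theorem nonempty_kolyvaginLocalPackageP
    [∀ v : Place K, Module (ZMod p) (galoisCohomology (((W.baseChange K).torsionGaloisModule ((p ^ 1 : ℕ) : ℤ)).toLocal v) 1)]
    [∀ v : Place K, CompactSpace (absoluteGaloisGroup (Place.Completion v))]
    [Finite (geomTorsion (W.baseChange K) ((p ^ 1 : ℕ) : ℤ))]
    (hK : IsImaginaryQuadratic K) (hp2 : p ≠ 2) (hd : NumberField.discr K < -4) (hsurj : W.HasSurjectiveModNGaloisRep p) (hc : c ≠ 1) :
    Nonempty (KolyvaginLocalPackageP W K p ι c) :=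
  kolyvaginLocalPackageP_of_poitouTate W K p ι c hK hp2 hd hsurj hc (poitouTate_selmerStructure_duality_holds K)

/-- **J2 — the two-prime jump, unconditionally** (the binder `hJ2` of `kolyvaginPrimitive_of_levelSystem_of_rankOne`, p567709; stub J2 of crux r2's
line, p576885 modulo Poitou–Tate): `K` imaginary quadratic, `p ≥ 5`, `c ≠ 1`; for an `ε`-class `x` spanning `Sel_∅^ε` and admissible `q₁ ≠ q₂`
whose places `v₁, v₂` detect `x`: `dim_{𝔽_p} Sel_{q₁q₂}^ε = 1` and `Sel_{q₁q₂}^{¬ε} = Sel_∅^{¬ε}` — `twoPrimeJump_of_poitouTate` at the Poitou–Tate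
theorem. [cite: WZhang2014, Lemma 5.3, Prop. 5.4, §9 (9.2)] [cite: MilneADT2006, Ch. I, Thm. 4.10 (b)] [cite: KlagsbrunMazurRubin2013, Thm. 3.1 (i)] -/
theorem twoPrimeJump (h5 : 5 ≤ p) (hK : IsImaginaryQuadratic K) (hc1 : c ≠ 1) :
    ∀ (ε : Bool) (x : Vp W K p) (q₁ q₂ : AdmQ W K p) (v₁ v₂ : HeightOneSpectrum (𝓞 K)),
      x ∈ SelQP W K p c ∅ ε → x ≠ 0 → (∀ y ∈ SelQP W K p c ∅ ε, ∃ a : ZMod p, y = a • x) → q₁ ≠ q₂ →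
      ((q₁ : ℕ) : 𝓞 K) ∈ v₁.asIdeal →
      x ∉ (W.baseChange K).torsionLocalKer (v₁.adicCompletion K) ((p ^ 1 : ℕ) : ℤ) →
      ((q₂ : ℕ) : 𝓞 K) ∈ v₂.asIdeal →
      x ∉ (W.baseChange K).torsionLocalKer (v₂.adicCompletion K) ((p ^ 1 : ℕ) : ℤ) →
      finrank (ZMod p) (SelQP W K p c {q₁, q₂} ε) = 1 ∧
        SelQP W K p c {q₁, q₂} (!ε) = SelQP W K p c ∅ (!ε) :=
  twoPrimeJump_of_poitouTate W K p c h5 hK hc1 (poitouTate_selmerStructure_duality_holds K)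

/-- **(R′) — the admissible raise, unconditionally** (the binder `hraise` of `selQP_coreConnected`; width seat w2 g2): `K` imaginary quadratic, `p`
odd; for `q ∉ m` admissible of sign `μ` at its place, if every class of `Sel_m^μ` is locally trivial above `q` then `Sel_m^μ ≤ Sel_{m∪q}^μ` and
`dim Sel_{m∪q}^μ = dim Sel_m^μ + 1` — `selQP_raise_free` at the Poitou–Tate theorem.
[cite: WZhang2014, Lemma 5.3, Prop. 5.4] [cite: Howard2006Bipartite, Prop. 2.4.11] [cite: MilneADT2006, Ch. I, Thm. 4.10 (b)] -/
theorem selQP_raise (hK : IsImaginaryQuadratic K) (hp2 : p ≠ 2) :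
    ∀ (m : Finset (AdmQ W K p)) (q : AdmQ W K p) (μ : Bool), q ∉ m →
      (∀ v : HeightOneSpectrum (𝓞 K), ((q : ℕ) : 𝓞 K) ∈ v.asIdeal → ∀ z : Vp W K p,
        (W.baseChange K).torsionLocMap (v.adicCompletion K) ((p ^ 1 : ℕ) : ℤ) (conjAct W c ((p ^ 1 : ℕ) : ℤ) z) =
          sgnP μ • (W.baseChange K).torsionLocMap (v.adicCompletion K) ((p ^ 1 : ℕ) : ℤ) z) →
      (∀ x ∈ SelQP W K p c m μ, ∀ v : HeightOneSpectrum (𝓞 K), ((q : ℕ) : 𝓞 K) ∈ v.asIdeal →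
        x ∈ (W.baseChange K).torsionLocalKer (v.adicCompletion K) ((p ^ 1 : ℕ) : ℤ)) →
      SelQP W K p c m μ ≤ SelQP W K p c (insert q m) μ ∧
        finrank (ZMod p) (SelQP W K p c (insert q m) μ) = finrank (ZMod p) (SelQP W K p c m μ) + 1 :=
  selQP_raise_free W K p hK hp2 c (poitouTate_selmerStructure_duality_holds K)

/-- **DICH — (Lower) ∧ (Raise) ∧ (TwoStep) at a ♯-type frame, unconditionally** (the displayed binder of lead g2's synthetic-system door
`levelKolyvaginSystemsAdditive_of_kolyvaginPrimitiveAdditive`, p624986): for `K` imaginary quadratic with `d_K < −4`, `p` odd, `ρ̄_{E,p}` onto,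
`c ≠ 1`, EVERY family `𝒮 n m μ` with the membership dictionary (μ-eigen; Kummer at `∞` and off `m ∪ n`; toric on `n`; transverse on `m`)
satisfies the conductor-direction dichotomies (Lower) (p625481) and (Raise) (parity-free, width seat w3's p628088) and the two-step admissible
lowering (TwoStep) (width seat w5's p630671) — `selmerDichotomy_of_poitouTate` at the Poitou–Tate theorem.
[cite: MazurRubin2004, Lemma 4.1.7] [cite: WZhang2014, Lemma 5.3, Prop. 5.4, Lemma 8.2, Lemma 8.4] [cite: MilneADT2006, Ch. I, Thm. 4.10 (b)] -/
theorem selmerDichotomy (hK : IsImaginaryQuadratic K) (hp2 : p ≠ 2) (hd : NumberField.discr K < -4)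
    (hsurj : W.HasSurjectiveModNGaloisRep p) (hc1 : c ≠ 1)
    (𝒮 : Finset (AdmQ W K p) → Finset {ℓ // Zhang2014.IsKolyvaginPrime (W.conductorNorm ℤ) W K p ℓ} → Bool →
      Submodule (ZMod p) (Vp W K p))
    (h𝒮 : ∀ (n : Finset (AdmQ W K p)) (m : Finset {ℓ // Zhang2014.IsKolyvaginPrime (W.conductorNorm ℤ) W K p ℓ})
      (μ : Bool) (x : Vp W K p), x ∈ 𝒮 n m μ ↔
        conjAct W c ((p ^ 1 : ℕ) : ℤ) x = sgnP μ • x ∧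
        (∀ w : InfinitePlace K, x ∈ selmerLocalKer (W.baseChange K) w.Completion ((p ^ 1 : ℕ) : ℤ)) ∧
        (∀ v : HeightOneSpectrum (𝓞 K), (∀ ℓ ∈ m, ((ℓ : ℕ) : 𝓞 K) ∉ v.asIdeal) → (∀ q ∈ n, ((q : ℕ) : 𝓞 K) ∉ v.asIdeal) →
          x ∈ selmerLocalKer (W.baseChange K) (v.adicCompletion K) ((p ^ 1 : ℕ) : ℤ)) ∧
        (∀ q ∈ n, ∀ v : HeightOneSpectrum (𝓞 K), ((q : ℕ) : 𝓞 K) ∈ v.asIdeal →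
          x ∈ toricLocalKer (W.baseChange K) (v.adicCompletion K) ((p ^ 1 : ℕ) : ℤ)) ∧
        (∀ ℓ ∈ m, ∀ v : HeightOneSpectrum (𝓞 K), ((ℓ : ℕ) : 𝓞 K) ∈ v.asIdeal → x ∈ transverseLocalKerP W K p ι ℓ v)) :
    (∀ (n : Finset (AdmQ W K p)) (m : Finset {ℓ // Zhang2014.IsKolyvaginPrime (W.conductorNorm ℤ) W K p ℓ})
        (ℓ : {ℓ // Zhang2014.IsKolyvaginPrime (W.conductorNorm ℤ) W K p ℓ}) (μ : Bool) (v : HeightOneSpectrum (𝓞 K)),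
        ℓ ∉ m → ((ℓ : ℕ) : 𝓞 K) ∈ v.asIdeal →
        (∃ x ∈ 𝒮 n m μ, x ∉ (W.baseChange K).torsionLocalKer (v.adicCompletion K) ((p ^ 1 : ℕ) : ℤ)) →
        (∀ y ∈ 𝒮 n (insert ℓ m) μ, y ∈ (W.baseChange K).torsionLocalKer (v.adicCompletion K) ((p ^ 1 : ℕ) : ℤ)) ∧
          finrank (ZMod p) (𝒮 n (insert ℓ m) μ) + 1 = finrank (ZMod p) (𝒮 n m μ)) ∧
    (∀ (n : Finset (AdmQ W K p)), n.Nonempty →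
      ∀ (m : Finset {ℓ // Zhang2014.IsKolyvaginPrime (W.conductorNorm ℤ) W K p ℓ})
        (ℓ : {ℓ // Zhang2014.IsKolyvaginPrime (W.conductorNorm ℤ) W K p ℓ}) (μ : Bool) (v : HeightOneSpectrum (𝓞 K)),
        ℓ ∉ m → ((ℓ : ℕ) : 𝓞 K) ∈ v.asIdeal →
        (∀ x ∈ 𝒮 n m μ, x ∈ (W.baseChange K).torsionLocalKer (v.adicCompletion K) ((p ^ 1 : ℕ) : ℤ)) →
        finrank (ZMod p) (𝒮 n (insert ℓ m) μ) = finrank (ZMod p) (𝒮 n m μ) + 1) ∧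
    (∀ (n : Finset (AdmQ W K p)) (q₁ q₂ : AdmQ W K p), n.Nonempty → Even n.card → q₁ ∉ n → q₂ ∉ insert q₁ n →
      ∀ (m : Finset {ℓ // Zhang2014.IsKolyvaginPrime (W.conductorNorm ℤ) W K p ℓ}) (μ : Bool),
        finrank (ZMod p) (𝒮 (insert q₂ (insert q₁ n)) m true) +
            finrank (ZMod p) (𝒮 (insert q₂ (insert q₁ n)) m false) = 1 →
        (∃ g ∈ 𝒮 (insert q₂ (insert q₁ n)) m μ, ∃ v : HeightOneSpectrum (𝓞 K), ((q₂ : ℕ) : 𝓞 K) ∈ v.asIdeal ∧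
          g ∉ (W.baseChange K).torsionLocalKer (v.adicCompletion K) ((p ^ 1 : ℕ) : ℤ)) →
        finrank (ZMod p) (𝒮 n m true) + finrank (ZMod p) (𝒮 n m false) = 1) :=
  selmerDichotomy_of_poitouTate W K p ι c hK hp2 hd hsurj hc1 (poitouTate_selmerStructure_duality_holds K) 𝒮 h𝒮

end Frame

/-- **(Twin) — Drop ∧ Rise ∧ Jump at a ♯-type frame, unconditionally** (the displayed binder `hTwin` of width seat w2's canonical-lines door
`levelKolyvaginSystemsAdditive_of_kolyvaginPrimitive_of_twin`, p626643): for `E = W` globally minimal, `p ≥ 5` with `ρ̄_{E,p}` onto, `K` imaginary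
quadratic with `d_K < −4`, a complex conjugation `c ≠ 1`, and EVERY family `Mix m n μ` with the membership dictionary of the mixed level spaces,
finite over `ZMod p`, the twin dichotomy {Drop, Rise, Jump} holds at every Kolyvagin prime `ℓ ∉ m` and every non-empty level `n` — lead g3's
`twin_of_poitouTate` (p629856 §2: LOC ⟹ (Lower), parity-free (Raise), `twin_of_localPackage_of_raise`) at the Poitou–Tate theorem.
[cite: Howard2004HeegnerKolyvagin, Lemma 2.5.3] [cite: WZhang2014, Lemma 8.2, Lemma 8.4] [cite: MazurRubin2004, Lemma 4.1.7] [cite: MilneADT2006, Ch. I, Thm. 4.10 (b)] -/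
theorem twin (W : WeierstrassCurve ℚ) [W.IsElliptic] [W.IsGloballyMinimal] [NeZero (W.conductorNorm ℤ)] (p : ℕ)
    [Fact p.Prime] (K : Type) [Field K] [NumberField K] (c : K ≃ₐ[ℚ] K) (ι : K →+* ℂ)
    (hp5 : 5 ≤ p) (hsurj : W.HasSurjectiveModNGaloisRep p) (hK : IsImaginaryQuadratic K) (hd : NumberField.discr K < -4) (hc1 : c ≠ 1)
    [Module (ZMod p) (Vp W K p)]
    (Mix : Finset {ℓ // Zhang2014.IsKolyvaginPrime (W.conductorNorm ℤ) W K p ℓ} → Finset (AdmQ W K p) → Bool → Submodule (ZMod p) (Vp W K p))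
    (hMix : ∀ (m : Finset {ℓ // Zhang2014.IsKolyvaginPrime (W.conductorNorm ℤ) W K p ℓ}) (n : Finset (AdmQ W K p)) (μ : Bool) (x : Vp W K p),
      x ∈ Mix m n μ ↔ (conjAct W c ((p ^ 1 : ℕ) : ℤ) x = sgnP μ • x ∧
        (∀ w : InfinitePlace K, x ∈ selmerLocalKer (W.baseChange K) w.Completion ((p ^ 1 : ℕ) : ℤ)) ∧
        (∀ v : HeightOneSpectrum (𝓞 K), (∀ ℓ ∈ m, ((ℓ : ℕ) : 𝓞 K) ∉ v.asIdeal) → (∀ q ∈ n, ((q : ℕ) : 𝓞 K) ∉ v.asIdeal) →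
          x ∈ selmerLocalKer (W.baseChange K) (v.adicCompletion K) ((p ^ 1 : ℕ) : ℤ)) ∧
        (∀ q ∈ n, ∀ v : HeightOneSpectrum (𝓞 K), ((q : ℕ) : 𝓞 K) ∈ v.asIdeal →
          x ∈ toricLocalKer (W.baseChange K) (v.adicCompletion K) ((p ^ 1 : ℕ) : ℤ)) ∧
        (∀ ℓ ∈ m, ∀ v : HeightOneSpectrum (𝓞 K), ((ℓ : ℕ) : 𝓞 K) ∈ v.asIdeal → x ∈ transverseLocalKerP W K p ι ℓ v)))
    (hfin : ∀ (m : Finset {ℓ // Zhang2014.IsKolyvaginPrime (W.conductorNorm ℤ) W K p ℓ}) (n : Finset (AdmQ W K p)) (μ : Bool),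
      Module.Finite (ZMod p) (Mix m n μ)) :
    (∀ (m : Finset {ℓ // Zhang2014.IsKolyvaginPrime (W.conductorNorm ℤ) W K p ℓ})
        (ℓ : {ℓ // Zhang2014.IsKolyvaginPrime (W.conductorNorm ℤ) W K p ℓ}) (n : Finset (AdmQ W K p)) (μ : Bool), ℓ ∉ m → n.Nonempty →
      (∃ x ∈ Mix m n μ, ¬ (∀ v : HeightOneSpectrum (𝓞 K), ((ℓ : ℕ) : 𝓞 K) ∈ v.asIdeal →
        x ∈ (W.baseChange K).torsionLocalKer (v.adicCompletion K) ((p ^ 1 : ℕ) : ℤ))) →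
      (∀ y, y ∈ Mix (insert ℓ m) n μ ↔ (y ∈ Mix m n μ ∧ (∀ v : HeightOneSpectrum (𝓞 K), ((ℓ : ℕ) : 𝓞 K) ∈ v.asIdeal →
        y ∈ (W.baseChange K).torsionLocalKer (v.adicCompletion K) ((p ^ 1 : ℕ) : ℤ)))) ∧
        finrank (ZMod p) (Mix (insert ℓ m) n μ) + 1 = finrank (ZMod p) (Mix m n μ)) ∧
    (∀ (m : Finset {ℓ // Zhang2014.IsKolyvaginPrime (W.conductorNorm ℤ) W K p ℓ})
        (ℓ : {ℓ // Zhang2014.IsKolyvaginPrime (W.conductorNorm ℤ) W K p ℓ}) (n : Finset (AdmQ W K p)) (μ : Bool), ℓ ∉ m → n.Nonempty →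
      (∃ y ∈ Mix (insert ℓ m) n μ, ¬ (∀ v : HeightOneSpectrum (𝓞 K), ((ℓ : ℕ) : 𝓞 K) ∈ v.asIdeal →
        y ∈ (W.baseChange K).torsionLocalKer (v.adicCompletion K) ((p ^ 1 : ℕ) : ℤ))) →
      (∀ x, x ∈ Mix m n μ ↔ (x ∈ Mix (insert ℓ m) n μ ∧ (∀ v : HeightOneSpectrum (𝓞 K), ((ℓ : ℕ) : 𝓞 K) ∈ v.asIdeal →
        x ∈ (W.baseChange K).torsionLocalKer (v.adicCompletion K) ((p ^ 1 : ℕ) : ℤ)))) ∧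
        finrank (ZMod p) (Mix m n μ) + 1 = finrank (ZMod p) (Mix (insert ℓ m) n μ)) ∧
    (∀ (m : Finset {ℓ // Zhang2014.IsKolyvaginPrime (W.conductorNorm ℤ) W K p ℓ})
        (ℓ : {ℓ // Zhang2014.IsKolyvaginPrime (W.conductorNorm ℤ) W K p ℓ}) (n : Finset (AdmQ W K p)) (μ : Bool), ℓ ∉ m → n.Nonempty →
      (∃ x ∈ Mix m n μ, ¬ (∀ v : HeightOneSpectrum (𝓞 K), ((ℓ : ℕ) : 𝓞 K) ∈ v.asIdeal →
        x ∈ (W.baseChange K).torsionLocalKer (v.adicCompletion K) ((p ^ 1 : ℕ) : ℤ))) ∨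
      (∃ y ∈ Mix (insert ℓ m) n μ, ¬ (∀ v : HeightOneSpectrum (𝓞 K), ((ℓ : ℕ) : 𝓞 K) ∈ v.asIdeal →
        y ∈ (W.baseChange K).torsionLocalKer (v.adicCompletion K) ((p ^ 1 : ℕ) : ℤ)))) :=
  twin_of_poitouTate W p K c ι hp5 hsurj hK hd hc1 (poitouTate_selmerStructure_duality_holds K) Mix hMix hfin

/-! ## §6 The frame-wise socket, input-free (appended 2026-08-28, same seat)

The registered line's composition consumes KS′'s FIBRE at one frame, not the route-level implication of §3.  Lead g3's socket
`nonempty_levelKolyvaginSystemP_of_kolyvaginClass_ne_zero_of_published` (Twin door, p629856) displays PUB and DUAL (PUB for the odd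
bottom rank via Cassels–Tate).  The DICH door needs neither: the synthetic system `nonempty_levelKolyvaginSystemP_of_selmerDichotomy`
(lead g2) runs on the intended family `exists_transverseLevelSpaces` and the dichotomies `selmerDichotomy` (§5, now hypothesis-free),
and its only frame inputs are `K` imaginary quadratic with `d_K < −4`, `p` odd, `ρ̄_{E,p}` onto, Heegner for `N_E`, `4N ∣ β² − d_K`
and the seed — no `Addv`, no ♠, no `p ∤ ∏ c_ℓ`, no `r_an = 1`, no `L(E^{d_K}, 1) ≠ 0`, no Manin clause, no published bundle. -/

/-- **KS′'s fibre at a frame FROM one non-zero Kolyvagin class at that frame — INPUT-FREE socket.** For `E = W` globally minimal, `p` an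
odd prime with `ρ̄_{E,p}` onto, `K` imaginary quadratic with `d_K < −4` satisfying the Heegner hypothesis for `N_E`, `4N_E ∣ β² − d_K`, and a
modular parametrisation datum `Dt`: if SOME Kolyvagin–Heegner datum of Kolyvagin-prime conductor has non-zero class `c(1)` in
`H¹(K, E[p])` (the conclusion of crux r2 `KolyvaginPrimitiveAdditive` AT THIS FRAME), then `Nonempty (LevelKolyvaginSystemP W K p Dt β ι c)`
for every complex conjugation `c ≠ 1` and every `ZMod p`-structure — with NO published bundle and NO displayed E-side binder (the frame
clauses `Addv`, ♠(1)(2), `p ∤ ∏ c_ℓ`, `r_an = 1`, `d_K` odd, `L(E^{d_K},1) ≠ 0`, `p ∤ c(Dt)` of the ♯ frame are not used either).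
Proof: lead g2's synthetic system `nonempty_levelKolyvaginSystemP_of_selmerDichotomy` on the intended family `exists_transverseLevelSpaces`,
the dichotomies (Lower) ∕ (Raise) ∕ (TwoStep) being `selmerDichotomy_of_poitouTate` at the Poitou–Tate THEOREM (p624636).  This is the
socket the deflated skeleton (lead g6's v14: one stub «KPA′ above the bottom», no cite-only stub) plugs its seed into.
[cite: WZhang2014, Thm. 4.3, Lemma 5.3, Prop. 5.4, Thm. 7.2, §8.1, Lemma 8.2, Lemma 8.4] [cite: MazurRubin2004, Lemma 4.1.7, Prop. 4.5.8]
[cite: MilneADT2006, Ch. I, Thm. 4.10 (b)] -/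
theorem nonempty_levelKolyvaginSystemP_of_kolyvaginClass_ne_zero
    (W : WeierstrassCurve ℚ) [W.IsElliptic] [W.IsGloballyMinimal] [NeZero (W.conductorNorm ℤ)]
    (p : ℕ) [Fact p.Prime] (K : Type) [Field K] [NumberField K]
    (Dt : ModularParametrizationData W (W.conductorNorm ℤ)) (β : ℤ) (ι : K →+* ℂ)
    (hp2 : p ≠ 2) (hs : W.HasSurjectiveModNGaloisRep p) (hK : IsImaginaryQuadratic K) (hlt : NumberField.discr K < -4)
    (hH : SatisfiesHeegnerHypothesis (W.conductorNorm ℤ) K) (hβ : (4 * (W.conductorNorm ℤ : ℤ)) ∣ β ^ 2 - NumberField.discr K)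
    (hseed : ∃ (n : ℕ) (d : KolyvaginHeegnerData Dt β ι n),
      KolyvaginDescent.KolSupp (Zhang2014.IsKolyvaginPrime (W.conductorNorm ℤ) W K p) n ∧ d.kolyvaginClass (Fact.out : p.Prime) 1 ≠ 0) :
    ∀ (c : K ≃ₐ[ℚ] K), c ≠ 1 → ∀ [Module (ZMod p) (Vp W K p)], Nonempty (LevelKolyvaginSystemP W K p Dt β ι c) := by
  intro c hc1 _
  obtain ⟨𝒮, h𝒮, hfin⟩ := exists_transverseLevelSpaces W K p ι c
  obtain ⟨hL, hR, hT⟩ :=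
    selmerDichotomy_of_poitouTate W K p ι c hK hp2 hlt hs hc1 (poitouTate_selmerStructure_duality_holds K) 𝒮 h𝒮
  exact nonempty_levelKolyvaginSystemP_of_selmerDichotomy W K p Dt β ι c hK hH hβ 𝒮 h𝒮 hfin
    (fun n _ _ m ℓ μ v ↦ hL n m ℓ μ v) (fun n hn _ ↦ hR n hn) hT hseed

/-- **The ♯-frame form of the input-free socket** — the exact binder list of the route's frame (as in lead g3's
`nonempty_levelKolyvaginSystemP_of_kolyvaginClass_ne_zero_of_published`, p629856, minus `hPUB` ∕ `hDual`), for drop-in use by the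
registered skeleton's `LevelKolyvaginSystemsAdditive_of`: at a ♯ rank-one additive frame, one non-zero Kolyvagin class of Kolyvagin-prime
conductor gives `Nonempty (LevelKolyvaginSystemP W K p Dt β ι c)` for every `c ≠ 1`. The idle frame clauses are accepted and discarded.
[cite: WZhang2014, Thm. 4.3, §8.1, §9] [cite: MilneADT2006, Ch. I, Thm. 4.10 (b)] -/
theorem nonempty_levelKolyvaginSystemP_of_kolyvaginClass_ne_zero_sharp
    (W : WeierstrassCurve ℚ) [W.IsElliptic] [W.IsGloballyMinimal] [NeZero (W.conductorNorm ℤ)]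
    (p : ℕ) [Fact p.Prime] (K : Type) [Field K] [NumberField K]
    (Dt : ModularParametrizationData W (W.conductorNorm ℤ)) (β : ℤ) (ι : K →+* ℂ)
    (hp5 : 5 ≤ p) (_hadd : Addv W p) (hs : W.HasSurjectiveModNGaloisRep p)
    (_hsp : ∀ (ℓ : ℕ) [Fact ℓ.Prime], W.HasMultiplicativeReductionAtPrime ℓ → ¬ p ∣ padicValInt ℓ W.minimalDiscriminantInt)
    (_htwo : ∃ (ℓ₁ ℓ₂ : ℕ) (_ : Fact ℓ₁.Prime) (_ : Fact ℓ₂.Prime), ℓ₁ ≠ ℓ₂ ∧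
      W.HasMultiplicativeReductionAtPrime ℓ₁ ∧ W.HasMultiplicativeReductionAtPrime ℓ₂)
    (_htam : ¬ p ∣ W.tamagawaProduct) (_hr : W.analyticRank = 1) (hK : IsImaginaryQuadratic K) (_hodd : Odd (NumberField.discr K))
    (hlt : NumberField.discr K < -4) (hH : SatisfiesHeegnerHypothesis (W.conductorNorm ℤ) K)
    (_hL : (W.quadraticTwist (NumberField.discr K : ℚ)).entireLFunction 1 ≠ 0)
    (hβ : (4 * (W.conductorNorm ℤ : ℤ)) ∣ β ^ 2 - NumberField.discr K) (_hcM : ¬ (p : ℤ) ∣ Dt.c)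
    (hseed : ∃ (n : ℕ) (d : KolyvaginHeegnerData Dt β ι n),
      KolyvaginDescent.KolSupp (Zhang2014.IsKolyvaginPrime (W.conductorNorm ℤ) W K p) n ∧ d.kolyvaginClass (Fact.out : p.Prime) 1 ≠ 0) :
    ∀ (c : K ≃ₐ[ℚ] K), c ≠ 1 → ∀ [Module (ZMod p) (Vp W K p)], Nonempty (LevelKolyvaginSystemP W K p Dt β ι c) :=
  nonempty_levelKolyvaginSystemP_of_kolyvaginClass_ne_zero W p K Dt β ι (by omega) hs hK hlt hH hβ hseed

end Summit.BirchSwinnertonDyer.BirchSwinnertonDyer.Theorems.AdditiveKoly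

end
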